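import Literature.RepresentationTheory.Semisimple.Multiplicity
import HarnessLib

/-!
# Decomposition of semisimple representations and Krull–Schmidt by multiplicities

Topic `Literature/RepresentationTheory/Semisimple` (sequel to `Multiplicity`; theorems only).
Over an algebraically closed field `k`, a finite-dimensional semisimple representation `ρ` of a
group `G` decomposes as `ρ ≃ ⊕ᵢ Tᵢ` with `Tᵢ` irreducible, and for every irreducible `U` the
multiplicity `[ρ : U] = dim_k Hom_G(U, ρ)` is the number of `i` with `U ≃ Tᵢ`; consequently
the multiplicities of pairwise non-equivalent irreducibles add up to at most `dim ρ`, and two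
finite-dimensional semisimple representations with the same multiplicities are equivalent
(Krull–Schmidt for semisimple modules; Curtis–Reiner, *Methods of Representation Theory* I,
(3.20)–(3.22); Bourbaki, *Algèbre* VIII § 4 n° 4).  All proved, by induction on the dimension
splitting off an irreducible subrepresentation and a complement (the tree's
`Representation.exists_ne_bot_isIrreducible`, `Subrepresentation.prodEquivOfIsCompl`,
`Subrepresentation.equivRange` from `FiniteGroups/EquivOfCharacter`):

* `Representation.exists_decomposition` — `∃ m ≤ dim ρ`, irreducible subrepresentations
  `T : Fin m → Subrepresentation ρ` with `[ρ : U] = #{i | U ≃ Tᵢ}` for all irreducible `U`;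
* `Representation.sum_mult_le_finrank` — `∑ⱼ [ρ : Uⱼ] ≤ dim ρ` for pairwise non-equivalent
  irreducible `Uⱼ`;
* `Representation.nonempty_equiv_of_mult_eq` — `[ρ : U] = [σ : U]` for all finite-dimensional
  irreducible `U` implies `ρ ≃ σ` (no hypothesis on `k`).

Used in `Literature/NumberTheory/GaloisRepresentations/TwistedSumAlgebraic` (discharge of
Harris–Lan–Taylor–Thorne's Prop. 7.12).
-/

noncomputable section

namespace Literature.RepresentationTheory.Semisimple

open scoped MonoidAlgebra
open Literature.RepresentationTheory.FiniteGroups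

universe u v w

variable {k : Type u} [Field k] {G : Type v} [Group G]

/-- The dimension of a representation is the sum of the dimensions of two complementary
subrepresentations. [folklore] -/
theorem Subrepresentation.finrank_add_eq_of_isCompl {V : Type w} [AddCommGroup V] [Module k V]
    [FiniteDimensional k V] {ρ : Representation k G V} {S Q : Subrepresentation ρ}
    (h : IsCompl S Q) : Module.finrank k S.toSubmodule + Module.finrank k Q.toSubmodule = Module.finrank k V := by
  rw [← (Submodule.prodEquivOfIsCompl _ _ (Subrepresentation.isCompl_toSubmodule ρ h)).finrank_eq,
    Module.finrank_prod]

open Classical in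
/-- Induction carrier for `Representation.exists_decomposition`. [folklore] -/
theorem Representation.exists_decomposition_aux [IsAlgClosed k] (n : ℕ) :
    ∀ {V : Type w} [AddCommGroup V] [Module k V] [FiniteDimensional k V]
      (ρ : Representation k G V) [ρ.IsSemisimpleRepresentation], Module.finrank k V ≤ n →
      ∃ (m : ℕ) (T : Fin m → Subrepresentation ρ), m ≤ Module.finrank k V ∧
        (∀ i, (T i).toRepresentation.IsIrreducible) ∧
        ∀ {X : Type w} [AddCommGroup X] [Module k X] [FiniteDimensional k X]
          (U : Representation k G X) [U.IsIrreducible],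
          Representation.mult U ρ = (Finset.univ.filter fun i =>
            Nonempty (Representation.Equiv U (T i).toRepresentation)).card := by
  induction n with
  | zero =>
    intro V _ _ _ ρ _ hV
    haveI : Subsingleton V := Module.finrank_zero_iff.mp (Nat.le_zero.mp hV)
    refine ⟨0, Fin.elim0, Nat.zero_le _, fun i => Fin.elim0 i, ?_⟩
    intro X _ _ _ U _
    rw [Representation.mult_eq_zero_of_subsingleton]
    simp
  | succ n ih =>
    intro V _ _ _ ρ _ hV
    rcases subsingleton_or_nontrivial V with hV0 | hV0
    · refine ⟨0, Fin.elim0, Nat.zero_le _, fun i => Fin.elim0 i, ?_⟩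
      intro X _ _ _ U _
      rw [Representation.mult_eq_zero_of_subsingleton]
      simp
    -- split off an irreducible subrepresentation `S` with complement `Q`
    obtain ⟨S, -, hS⟩ := Representation.exists_ne_bot_isIrreducible ρ
    haveI := hS
    obtain ⟨Q, hSQ⟩ := exists_isCompl S
    haveI : Q.toRepresentation.IsSemisimpleRepresentation :=
      Subrepresentation.isSemisimpleRepresentation_toRepresentation Q
    haveI : Nontrivial S.toSubmodule := Representation.nontrivial_of_isIrreducible S.toRepresentation
    have hdim := Subrepresentation.finrank_add_eq_of_isCompl hSQ
    have hSpos : 0 < Module.finrank k S.toSubmodule := Module.finrank_pos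
    have hQn : Module.finrank k Q.toSubmodule ≤ n := by omega
    obtain ⟨m, T', hm, hT'irr, hT'⟩ := ih Q.toRepresentation hQn
    -- transport the constituents of `Q` into `ρ`
    let f : ∀ i, Representation.IntertwiningMap (T' i).toRepresentation ρ := fun i =>
      (Subrepresentation.subtypeIntertwiningMap Q).comp
        (Subrepresentation.subtypeIntertwiningMap (T' i))
    have hf : ∀ i, Function.Injective (f i) := fun i x y hxy =>
      Subrepresentation.subtypeIntertwiningMap_injective (T' i)
        (Subrepresentation.subtypeIntertwiningMap_injective Q hxy)
    let ι : Fin m → Subrepresentation ρ := fun i => (f i).range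
    have eι : ∀ i, Representation.Equiv (T' i).toRepresentation (ι i).toRepresentation :=
      fun i => Subrepresentation.equivRange (f i) (hf i)
    have hirr : ∀ i, ((Fin.cons S ι : Fin (m + 1) → Subrepresentation ρ) i)
        |>.toRepresentation.IsIrreducible := by
      intro i
      refine Fin.cases ?_ (fun i => ?_) i
      · rw [Fin.cons_zero]; exact hS
      · rw [Fin.cons_succ]
        haveI := hT'irr i
        exact Representation.isIrreducible_of_equiv (eι i)
    refine ⟨m + 1, Fin.cons S ι, by omega, hirr, ?_⟩
    intro X _ _ _ U _
    rw [Representation.mult_congr_right U (Subrepresentation.prodEquivOfIsCompl ρ S Q hSQ).symm,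
      Representation.mult_prod, hT' U, Representation.mult_eq_ite, Finset.card_filter,
      Finset.card_filter, Fin.sum_univ_succ]
    -- `Fin.cons S ι 0 = S` and `Fin.cons S ι i.succ = ι i`, definitionally
    change ((if Nonempty (Representation.Equiv U S.toRepresentation) then 1 else 0) +
        ∑ i : Fin m, if Nonempty (Representation.Equiv U (T' i).toRepresentation) then 1 else 0) =
      (if Nonempty (Representation.Equiv U S.toRepresentation) then 1 else 0) +
        ∑ i : Fin m, if Nonempty (Representation.Equiv U (ι i).toRepresentation) then 1 else 0
    refine congrArg₂ (· + ·) rfl (Finset.sum_congr rfl fun i _ => ?_)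
    have hiff : Nonempty (Representation.Equiv U (T' i).toRepresentation) ↔
        Nonempty (Representation.Equiv U (ι i).toRepresentation) :=
      ⟨fun ⟨g⟩ => ⟨g.trans (eι i)⟩, fun ⟨g⟩ => ⟨g.trans (eι i).symm⟩⟩
    by_cases h : Nonempty (Representation.Equiv U (T' i).toRepresentation)
    · rw [if_pos h, if_pos (hiff.mp h)]
    · rw [if_neg h, if_neg (fun h' => h (hiff.mpr h'))]

open Classical in
/-- **Decomposition into irreducibles, with multiplicities.**  A finite-dimensional semisimple
representation `ρ` over an algebraically closed field has finitely many irreducible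
subrepresentations `T₁, …, Tₘ` (`m ≤ dim ρ`) such that `ρ ≃ ⊕ Tᵢ` in the sense that for every
finite-dimensional irreducible `U`, the multiplicity `[ρ : U] = dim Hom_G(U, ρ)` is the number of
indices `i` with `U ≃ Tᵢ` (Krull–Schmidt counting via Schur's lemma). [folklore] -/
theorem Representation.exists_decomposition [IsAlgClosed k] {V : Type w} [AddCommGroup V]
    [Module k V] [FiniteDimensional k V] (ρ : Representation k G V)
    [ρ.IsSemisimpleRepresentation] :
    ∃ (m : ℕ) (T : Fin m → Subrepresentation ρ), m ≤ Module.finrank k V ∧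
      (∀ i, (T i).toRepresentation.IsIrreducible) ∧
      ∀ {X : Type w} [AddCommGroup X] [Module k X] [FiniteDimensional k X]
        (U : Representation k G X) [U.IsIrreducible],
        Representation.mult U ρ = (Finset.univ.filter fun i =>
          Nonempty (Representation.Equiv U (T i).toRepresentation)).card :=
  Representation.exists_decomposition_aux (Module.finrank k V) ρ le_rfl

open Classical in
/-- **Multiplicities are bounded by the dimension.**  For pairwise non-equivalent irreducible
`U_j` (`j ∈ s`), `∑_j [ρ : U_j] ≤ dim ρ`. [folklore] -/
theorem Representation.sum_mult_le_finrank [IsAlgClosed k] {V : Type w} [AddCommGroup V]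
    [Module k V] [FiniteDimensional k V] (ρ : Representation k G V)
    [ρ.IsSemisimpleRepresentation] {X : Type w} [AddCommGroup X] [Module k X]
    [FiniteDimensional k X] {ι : Type*} (s : Finset ι) (U : ι → Representation k G X)
    (hU : ∀ j ∈ s, (U j).IsIrreducible)
    (hne : ∀ j ∈ s, ∀ j' ∈ s, j ≠ j' → IsEmpty (Representation.Equiv (U j) (U j'))) :
    ∑ j ∈ s, Representation.mult (U j) ρ ≤ Module.finrank k V := by
  obtain ⟨m, T, hm, hT, hcount⟩ := Representation.exists_decomposition ρ
  calc ∑ j ∈ s, Representation.mult (U j) ρ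
      = ∑ j ∈ s, ∑ i : Fin m,
          if Nonempty (Representation.Equiv (U j) (T i).toRepresentation) then 1 else 0 := by
        refine Finset.sum_congr rfl fun j hj => ?_
        haveI := hU j hj
        rw [hcount (U j), Finset.card_filter]
    _ = ∑ i : Fin m, ∑ j ∈ s,
          if Nonempty (Representation.Equiv (U j) (T i).toRepresentation) then 1 else 0 :=
        Finset.sum_comm
    _ ≤ ∑ _i : Fin m, 1 := by
        refine Finset.sum_le_sum fun i _ => ?_
        rw [← Finset.card_filter]
        refine Finset.card_le_one.mpr fun j hj j' hj' => ?_
        rw [Finset.mem_filter] at hj hj'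
        by_contra hjj'
        obtain ⟨e⟩ := hj.2
        obtain ⟨e'⟩ := hj'.2
        exact (hne j hj.1 j' hj'.1 hjj').false (e.trans e'.symm)
    _ = m := by simp
    _ ≤ Module.finrank k V := hm

/-- Induction carrier for `Representation.nonempty_equiv_of_mult_eq`. [folklore] -/
theorem Representation.nonempty_equiv_of_mult_eq_aux (n : ℕ) :
    ∀ {V V' : Type w} [AddCommGroup V] [Module k V] [FiniteDimensional k V]
      [AddCommGroup V'] [Module k V'] [FiniteDimensional k V']
      (ρ : Representation k G V) (σ : Representation k G V')
      [ρ.IsSemisimpleRepresentation] [σ.IsSemisimpleRepresentation], Module.finrank k V ≤ n →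
      (∀ {X : Type w} [AddCommGroup X] [Module k X] [FiniteDimensional k X]
        (U : Representation k G X) [U.IsIrreducible],
        Representation.mult U ρ = Representation.mult U σ) →
      Nonempty (Representation.Equiv ρ σ) := by
  induction n with
  | zero =>
    intro V V' _ _ _ _ _ _ ρ σ _ _ hV h
    haveI : Subsingleton V := Module.finrank_zero_iff.mp (Nat.le_zero.mp hV)
    haveI : Subsingleton V' := by
      by_contra hV'
      rw [not_subsingleton_iff_nontrivial] at hV'
      obtain ⟨S', -, hS'⟩ := Representation.exists_ne_bot_isIrreducible σ
      haveI := hS'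
      haveI : Nontrivial S'.toSubmodule :=
        Representation.nontrivial_of_isIrreducible S'.toRepresentation
      have h1 := Subrepresentation.mult_toRepresentation_pos S'
      rw [← h S'.toRepresentation, Representation.mult_eq_zero_of_subsingleton] at h1
      exact lt_irrefl 0 h1
    exact ⟨Representation.Equiv.mk (LinearEquiv.ofSubsingleton V V') fun g =>
      LinearMap.ext fun v => Subsingleton.elim _ _⟩
  | succ n ih =>
    intro V V' _ _ _ _ _ _ ρ σ _ _ hV h
    rcases subsingleton_or_nontrivial V with hV0 | hV0
    · exact ih ρ σ (by rw [Module.finrank_zero_of_subsingleton]; exact Nat.zero_le _) h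
    -- an irreducible `S ⊆ ρ`, which also occurs in `σ`
    obtain ⟨S, -, hS⟩ := Representation.exists_ne_bot_isIrreducible ρ
    haveI := hS
    haveI : Nontrivial S.toSubmodule := Representation.nontrivial_of_isIrreducible S.toRepresentation
    have hpos := Subrepresentation.mult_toRepresentation_pos S
    rw [h S.toRepresentation, Representation.mult_pos_iff] at hpos
    obtain ⟨f, hf⟩ := hpos
    have hfinj : Function.Injective f :=
      (Representation.IsIrreducible.injective_or_eq_zero f).resolve_right hf
    let S' : Subrepresentation σ := f.range
    let e₁ : Representation.Equiv S.toRepresentation S'.toRepresentation :=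
      Subrepresentation.equivRange f hfinj
    -- complements
    obtain ⟨Q, hSQ⟩ := exists_isCompl S
    obtain ⟨Q', hSQ'⟩ := exists_isCompl S'
    haveI : Q.toRepresentation.IsSemisimpleRepresentation :=
      Subrepresentation.isSemisimpleRepresentation_toRepresentation Q
    haveI : Q'.toRepresentation.IsSemisimpleRepresentation :=
      Subrepresentation.isSemisimpleRepresentation_toRepresentation Q'
    let eρ := Subrepresentation.prodEquivOfIsCompl ρ S Q hSQ
    let eσ := Subrepresentation.prodEquivOfIsCompl σ S' Q' hSQ'
    -- multiplicities in the complements agree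
    have hQ : ∀ {X : Type w} [AddCommGroup X] [Module k X] [FiniteDimensional k X]
        (U : Representation k G X) [U.IsIrreducible],
        Representation.mult U Q.toRepresentation = Representation.mult U Q'.toRepresentation := by
      intro X _ _ _ U _
      have h1 := h U
      rw [Representation.mult_congr_right U eρ.symm, Representation.mult_congr_right U eσ.symm,
        Representation.mult_prod, Representation.mult_prod,
        Representation.mult_congr_right U e₁] at h1
      exact Nat.add_left_cancel h1
    -- the dimension drops
    have hdim := Subrepresentation.finrank_add_eq_of_isCompl hSQ
    have hSpos : 0 < Module.finrank k S.toSubmodule := Module.finrank_pos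
    have hQn : Module.finrank k Q.toSubmodule ≤ n := by omega
    obtain ⟨e₂⟩ := ih Q.toRepresentation Q'.toRepresentation hQn hQ
    exact ⟨eρ.symm.trans ((Representation.Equiv.prodCongr e₁ e₂).trans eσ)⟩

/-- **A finite-dimensional semisimple representation is determined, up to equivalence, by the
multiplicities of the irreducibles in it**: if `[ρ : U] = [σ : U]` for every
finite-dimensional irreducible `U`, then `ρ ≃ σ`.  (Krull–Schmidt for semisimple
representations; no hypothesis on the field beyond what `mult` needs.) [folklore] -/
theorem Representation.nonempty_equiv_of_mult_eq {V V' : Type w} [AddCommGroup V] [Module k V]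
    [FiniteDimensional k V] [AddCommGroup V'] [Module k V'] [FiniteDimensional k V']
    (ρ : Representation k G V) (σ : Representation k G V')
    [ρ.IsSemisimpleRepresentation] [σ.IsSemisimpleRepresentation]
    (h : ∀ {X : Type w} [AddCommGroup X] [Module k X] [FiniteDimensional k X]
      (U : Representation k G X) [U.IsIrreducible],
      Representation.mult U ρ = Representation.mult U σ) :
    Nonempty (Representation.Equiv ρ σ) :=
  Representation.nonempty_equiv_of_mult_eq_aux (Module.finrank k V) ρ σ le_rfl h

end Literature.RepresentationTheory.Semisimple
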